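import Summits.FinalStateConjecture.FinalStateConjecture.Theorems.SettledCapture.Negative.TypedNormalForm

/-!
# Sketch — crux-ideate `SettledCapture` (stmt-FinalStateConjecture-17328), ideator 2, round 1

First lemmas of the three idea cards (they need not be proved; they must elaborate).

* Card `extremal-endstate-dodge` (negation): `IsExactKerrLateChart`, `HasExactKerrLateExterior/Doc`,
  `KerrLateExteriorDodge` (K1+K2), `SubextremalChartRigidity` (K3), `NoExtremalCriticalCollapse`, and
  the composed reductions `noExtremalCriticalCollapse_of_settledCapture`,
  `not_settledCapture_of_extremalCriticalCollapse` (SORRY-FREE).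
* Card `tendril-swarm-rays` : `NeedleAt`, `InvisibleRaysNeedleChartable` (the GR residual) and the
  reshaped rays stub `t2Conclusion_of_exterior_of_needleChartable` (shape only, `sorry`).
* Card `null-concave-crush` : the abstract exit lemma `exit_of_weightedConcave` (provable now, here
  `sorry`) and the certificate stub `KerrCrushCertificate`.
-/

set_option linter.dupNamespace false

noncomputable section

open Set Filter TopologicalSpace
open scoped Manifold ContDiff Topology ENNReal
open Literature.Geometry.Lorentzian
open Summit.FinalStateConjecture.FinalStateConjecture.Theses
open Summit.FinalStateConjecture.FinalStateConjecture.Theorems.SettledCapture.Negative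

namespace Summit.FinalStateConjecture.FinalStateConjecture.Cruxes.SettledCapture.Ideator2

variable {X : Type} [TopologicalSpace X] [ChartedSpace E3 X] [IsManifold (𝓡 3) ∞ X]
  [T2Space X] [SecondCountableTopology X] [ConnectedSpace X] {D : InitialDataSet (𝓡 3) X}

/-! ## Card 1 — extremal-endstate-dodge (negation lens) -/

/-- The star-chart model background of Kerr `(M, a)` in the Poincaré frame `mo` (as in the crux). -/
abbrev kerrStar (mo : lorentzGroup × E4) (M a : ℝ) : ModelBackground :=
  starBackground mo.1 mo.2 M a (fun x => Kerr.radius a (poincareInv mo.1 mo.2 x))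

/-- `Φ` is an **exact late Kerr `(M, a)` exterior chart beyond `K`** in the frame `mo` after star
time `T`: on the late exterior region `F = {T < t*, r₊ < r}` of the star background, `Φ` is smooth,
an open embedding, EXACTLY isometric (`deviation = 0`: boosted Kerr–Schild/star form), future-oriented
(`Λ e₀ ↦` future-directed), lands in `J⁺(ιΣ)` and misses `J⁻(K)`. -/
def IsExactKerrLateChart (𝒟 : VacuumCauchyDevelopment D) (M a : ℝ) (K : Set 𝒟.carrier)
    (mo : lorentzGroup × E4) (T : ℝ) (Φ : (kerrStar mo M a).domain → 𝒟.carrier) : Prop :=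
  let F : Set (kerrStar mo M a).domain :=
    {x | T < poincareInv mo.1 mo.2 x.1 0 ∧ Kerr.rPlus M a < Kerr.radius a (poincareInv mo.1 mo.2 x.1)}
  ContMDiffOn 𝓘(ℝ, E4) (𝓡 4) ∞ Φ F ∧ Topology.IsOpenEmbedding (F.restrict Φ) ∧
  (∀ x ∈ F, 𝒟.toSpacetime.deviation (kerrStar mo M a) Φ x = 0) ∧
  (∀ x ∈ F, 𝒟.timeOrientation.IsFutureDirected
    (mfderiv 𝓘(ℝ, E4) (𝓡 4) Φ x ((mo.1 : E4 ≃L[ℝ] E4) (E4.basisVector 0)))) ∧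
  Φ '' F ⊆ 𝒟.metric.causalFuture 𝒟.timeOrientation (range 𝒟.embed) ∧
  Disjoint (Φ '' F) (𝒟.metric.causalPast 𝒟.timeOrientation K)

/-- The **covering clause**: the chart's late exterior image IS the whole late domain of outer
communications — every point of `J⁺(ιΣ) ∩ I⁻(image)` outside the image lies in `J⁻(K)`. -/
def CoversLateDoc (𝒟 : VacuumCauchyDevelopment D) (M a : ℝ) (K : Set 𝒟.carrier)
    (mo : lorentzGroup × E4) (T : ℝ) (Φ : (kerrStar mo M a).domain → 𝒟.carrier) : Prop :=
  let F : Set (kerrStar mo M a).domain :=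
    {x | T < poincareInv mo.1 mo.2 x.1 0 ∧ Kerr.rPlus M a < Kerr.radius a (poincareInv mo.1 mo.2 x.1)}
  ((𝒟.metric.causalFuture 𝒟.timeOrientation (range 𝒟.embed) ∩
      𝒟.metric.chronologicalPast 𝒟.timeOrientation (Φ '' F)) \ Φ '' F) ⊆
    𝒟.metric.causalPast 𝒟.timeOrientation K

/-- `𝒟` **has an exact late Kerr `(M, a)` exterior beyond every compact set** (no covering asked):
Kehle–Unger's conjectured extremal critical solutions (arXiv:2402.10190, Conj. 5: d.o.c. isometric
to extremal Kerr after large advanced time; `{t* > T} ⊆ {v ≥ v₀}`) and every eventually-exactly-Kerr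
collapse (arXiv:2304.08455, `|a| ≤ a₀ M`) have it. -/
def HasExactKerrLateExterior (𝒟 : VacuumCauchyDevelopment D) (M a : ℝ) : Prop :=
  ∀ K : Set 𝒟.carrier, IsCompact K →
    ∃ (mo : lorentzGroup × E4) (T : ℝ) (Φ : (kerrStar mo M a).domain → 𝒟.carrier),
      IsExactKerrLateChart 𝒟 M a K mo T Φ

/-- `𝒟` **is eventually exactly Kerr `(M, a)` in its domain of outer communications**: as above,
with the covering clause. -/
def HasExactKerrLateDoc (𝒟 : VacuumCauchyDevelopment D) (M a : ℝ) : Prop :=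
  ∀ K : Set 𝒟.carrier, IsCompact K →
    ∃ (mo : lorentzGroup × E4) (T : ℝ) (Φ : (kerrStar mo M a).domain → 𝒟.carrier),
      IsExactKerrLateChart 𝒟 M a K mo T Φ ∧ CoversLateDoc 𝒟 M a K mo T Φ

omit [T2Space X] [SecondCountableTopology X] in
theorem HasExactKerrLateDoc.hasExactKerrLateExterior {𝒟 : VacuumCauchyDevelopment D} {M a : ℝ}
    (h : HasExactKerrLateDoc 𝒟 M a) : HasExactKerrLateExterior 𝒟 M a := fun K hK => by
  obtain ⟨mo, T, Φ, h₁, -⟩ := h K hK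
  exact ⟨mo, T, Φ, h₁⟩

/-- **K1 + K2 — the Kerr late-exterior DODGE (first lemma of card 1).** A development with an exact
late Kerr exterior (`0 < M`, `|a| ≤ M`, extremal allowed) satisfies the crux's typed leaf
hypothesis `LeafHyp` with `N₀ = 0`: the boosted time-stretched hyperboloid of
`NearKerrLeafMinkowskiBoostedDodge.lean`, transported by `Φ` into the far quadrant
`{x¹ > Dist ≳ M/ε²}` of the late exterior, is a typed `(ε,k)`-near-Kerr leaf with `0` holes beyond
`J⁻(K)`: Kerr–Schild deviation `H ℓ⊗ℓ`, `0 ≤ H ≤ 2M/r`, `|∂ʲH| ≲ M/r^{1+j}`, is `O(γ²M/Dist) ≤ ε/2`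
in `Cᵏ` after the `γ ≍ ε^{-1/2}` boost, uniformly in time by STATIONARITY; `g`-cones lie inside
`η`-cones (`g(k,k) = H(ℓ·k)² ≥ 0` on `η`-null `k`) and `g`-timelike near-null rays of slope `1 − O(ε)`
still re-cross the superluminal sheet (asymptotic slope `(a+v)/(1+va) > 1`), giving `W₀ ⊆ I⁺(S)` and
the barrier clause via `p ≪ w ≤ s`. -/
def KerrLateExteriorDodge : Prop :=
  ∀ (X : Type) [TopologicalSpace X] [ChartedSpace E3 X] [IsManifold (𝓡 3) ∞ X] [T2Space X]
    [SecondCountableTopology X] [ConnectedSpace X], ∀ (D : InitialDataSet (𝓡 3) X)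
    (𝒟 : VacuumCauchyDevelopment D) (M a : ℝ), 0 < M → |a| ≤ M →
    HasExactKerrLateExterior 𝒟 M a → LeafHyp 𝒟

/-- **K3 — sub-extremal chart rigidity at an extremal end.** An MGHD whose late d.o.c. is EXACTLY
extremal Kerr `(M, ±M)` admits NO `C²` final-state decomposition with sub-extremal labels, exhaustive
honest charts and the rays clause: `HasExhaustiveCharts` (∀ τ₁) forces the hole chart onto a full
late outer neighbourhood of the degenerate horizon; its level spheres `{t* = τ, r = r₊(M₁,a₁) + η}`
are `C²`-close to sub-extremal Kerr horizon sections and converge (`η → 0`, `τ → ∞`) to cross-sections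
of a Killing horizon, all mutually isometric; the scale-free invariant `K_max · Area/4π = (1 + a²/r₊²)²`
is `< 4` for `|a₁| < M₁` and `= 4` at extremality (Smarr, PRD 7 (1973) 289). -/
def SubextremalChartRigidity : Prop :=
  ∀ (X : Type) [TopologicalSpace X] [ChartedSpace E3 X] [IsManifold (𝓡 3) ∞ X] [T2Space X]
    [SecondCountableTopology X] [ConnectedSpace X], ∀ (D : InitialDataSet (𝓡 3) X)
    (𝒟 : VacuumCauchyDevelopment D) (M a : ℝ), 0 < M → |a| = M →
    HasExactKerrLateDoc 𝒟 M a → ¬ T2Conclusion 𝒟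

/-- **The weakest consequence card 1 isolates**: no admissible datum has an MGHD with complete `𝓘⁺`
whose late domain of outer communications is EXACTLY extremal Kerr — i.e. vacuum extremal critical
collapse à la Kehle–Unger (arXiv:2402.10190, Conjecture 5) does not occur in the smooth admissible
class. Typed `SettledCapture` implies it (next theorem); Conjecture 5 (believed; its
Einstein–Maxwell–charged-scalar-field and –Vlasov analogues are theorems: arXiv:2211.15742 Thm 1,
arXiv:2402.10190 Thm 1) negates it. -/
def NoExtremalCriticalCollapse : Prop :=
  ∀ (X : Type) [TopologicalSpace X] [ChartedSpace E3 X] [IsManifold (𝓡 3) ∞ X] [T2Space X]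
    [SecondCountableTopology X] [ConnectedSpace X], ∀ D ∈ admissibleVacuumData X,
    ∀ (𝒟 : VacuumCauchyDevelopment D) (M a : ℝ), 𝒟.IsMaximal →
    Summit.FinalStateConjecture.HasCompleteNullInfinity 𝒟.toCauchyDevelopment → 0 < M → |a| = M →
    ¬ HasExactKerrLateDoc 𝒟 M a

/-- **The composed reduction of card 1 (sorry-free):** typed `SettledCapture` + K1/K2 + K3 ⇒ the
anti-Kehle–Unger statement. Equivalently `KU5 ∧ K1 ∧ K3 ⇒ ¬ SettledCapture`. -/
theorem noExtremalCriticalCollapse_of_settledCapture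
    (h : BartnikGapSettling.SettledCapture) (h₁ : KerrLateExteriorDodge)
    (h₃ : SubextremalChartRigidity) : NoExtremalCriticalCollapse := by
  intro X _ _ _ _ _ _ D hD 𝒟 M a hmax hscri hM ha hdoc
  have hleaf : LeafHyp 𝒟 :=
    h₁ X D 𝒟 M a hM (le_of_eq ha) hdoc.hasExactKerrLateExterior
  exact h₃ X D 𝒟 M a hM ha hdoc (settledCapture_iff.mp h X D hD 𝒟 hmax hscri hleaf)

/-- The same, contrapositive form: Kehle–Unger's Conjecture 5 (with complete `𝓘⁺`, smooth class)
refutes the typed crux GIVEN K1 and K3 — the shape of a HELD negative lemma `H → ¬ SettledCapture`. -/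
theorem not_settledCapture_of_extremalCriticalCollapse (h₁ : KerrLateExteriorDodge)
    (h₃ : SubextremalChartRigidity) (hKU : ¬ NoExtremalCriticalCollapse) :
    ¬ BartnikGapSettling.SettledCapture :=
  fun h => hKU (noExtremalCriticalCollapse_of_settledCapture h h₁ h₃)

/-! ## Card 2 — tendril-swarm-rays -/

/-- A **`δ`-flat needle at `q`**: a smooth open embedding of an open `U ∋ 0` of `E4` into `𝒟`
with `Φ 0 = q`, whose full `C²` deviation from `η` on every flat slab of `U` is `≤ δ` (a candidate
extra component — a TENDRIL — of a final-state decomposition's flat domain). -/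
def NeedleAt (𝒟 : VacuumCauchyDevelopment D) (q : 𝒟.carrier) (δ : ℝ≥0∞) : Prop :=
  ∃ (U : Opens E4) (h0 : (0 : E4) ∈ U) (Φ : U → 𝒟.carrier), Φ ⟨0, h0⟩ = q ∧
    ContMDiff 𝓘(ℝ, E4) (𝓡 4) ∞ Φ ∧ Topology.IsOpenEmbedding Φ ∧
    ∀ τ : ℝ, 𝒟.toSpacetime.deviationCk (Minkowski.backgroundOn U) Φ 2 τ ≤ δ

/-- **The GR residual of card 2 (INVISIBLE COMPLETE RAYS DECURVE).** In an MGHD of an admissible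
datum with complete `𝓘⁺`, let `(O, d)` be an exterior decomposition (sub-extremal holes,
`O = exteriorOf`, exhaustive charts, future-oriented). Then along every future-complete normalised
null ray from `Σ`, beyond every parameter, the ray is either VISIBLE (`γ t' ∈ closure d.charted`) or
NEEDLE-CHARTABLE to every accuracy (`NeedleAt 𝒟 (γ t') δ` for all `δ > 0`, cofinally): complete rays
the exterior charts never see live in expanding, decurving regions (pockets), never in crushing ones
(Anderson CMP 222; Lott AHP 2018; blue-shift/crush for trapped regions, card `null-concave-crush`). -/
def InvisibleRaysNeedleChartable : Prop :=
  ∀ (X : Type) [TopologicalSpace X] [ChartedSpace E3 X] [IsManifold (𝓡 3) ∞ X] [T2Space X]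
    [SecondCountableTopology X] [ConnectedSpace X], ∀ D ∈ admissibleVacuumData X,
    ∀ 𝒟 : VacuumCauchyDevelopment D, 𝒟.IsMaximal →
    Summit.FinalStateConjecture.HasCompleteNullInfinity 𝒟.toCauchyDevelopment →
    ∀ (O : Set 𝒟.carrier) (d : FinalStateDecomposition 𝒟.toSpacetime O 2),
    (∀ i, Kerr.IsSubextremal (d.mass i) (d.spin i)) →
    O = Summit.FinalStateConjecture.exteriorOf 𝒟.toCauchyDevelopment d.charted →
    Summit.FinalStateConjecture.HasExhaustiveCharts d → Summit.FinalStateConjecture.IsFutureOriented d →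
    ∀ [𝒟.metric.HasLeviCivita], ∀ (p : X) (γ : ℝ → 𝒟.carrier) (dom : Set ℝ),
    𝒟.metric.IsNormalisedNullRayFrom 𝒟.timeOrientation 𝒟.embed 𝒟.normal p γ dom → ¬ BddAbove dom →
    ∀ t ∈ dom, (∃ t' ∈ dom, t ≤ t' ∧ γ t' ∈ closure d.charted) ∨
      (∀ δ : ℝ≥0∞, 0 < δ → ∃ t' ∈ dom, t ≤ t' ∧ NeedleAt 𝒟 (γ t') δ)

/-- **Reshaped rays stub of card 2 (shape): TENDRIL SWARM.** Exterior capture `(O, d)` + the decurving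
dichotomy ⇒ the full T2 conclusion, by AUGMENTING `d`'s flat chart with a countable swarm of needles
(extra components of `flatDomain`, legal under `setOf_lt_excision_subset_flatDomain`; chart times
assigned from `τ₀⁺` upward along each needle, needles born ever later so that every level-`τ₁`
certified slab has pieces in the future of every late pocket point — the construction of the
rattack-18854-g2 "swarm of thin flat tubes", here turned into a proof device). -/
theorem t2Conclusion_of_exterior_of_needleChartable (hres : InvisibleRaysNeedleChartable) :
    ∀ (X : Type) [TopologicalSpace X] [ChartedSpace E3 X] [IsManifold (𝓡 3) ∞ X] [T2Space X]
      [SecondCountableTopology X] [ConnectedSpace X], ∀ D ∈ admissibleVacuumData X,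
      ∀ 𝒟 : VacuumCauchyDevelopment D, 𝒟.IsMaximal →
      Summit.FinalStateConjecture.HasCompleteNullInfinity 𝒟.toCauchyDevelopment →
      (∃ (O : Set 𝒟.carrier) (d : FinalStateDecomposition 𝒟.toSpacetime O 2),
        (∀ i, Kerr.IsSubextremal (d.mass i) (d.spin i)) ∧
        O = Summit.FinalStateConjecture.exteriorOf 𝒟.toCauchyDevelopment d.charted ∧
        Summit.FinalStateConjecture.HasExhaustiveCharts d ∧
        Summit.FinalStateConjecture.IsFutureOriented d) →
      T2Conclusion 𝒟 := by
  sorry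

/-! ## Card 3 — null-concave-crush -/

/-- **Abstract exit lemma (first lemma of card 3; real analysis + bookkeeping, provable now).**
Let `B` be a FUTURE-ABSORBING region for normalised null rays from `Σ` and `f > 0` on `B` a
**weighted null-concave crush function**: along every ray segment inside `B`, `h = f ∘ γ` is `C²`,
strictly decreasing, and `h · h'' ≤ ρ · h'²` with `ρ < 1` (`ρ ≤ 0` = plain null-concavity of `f`,
i.e. `∇²f(k,k) ≤ 0` on null `k`). Then no future-COMPLETE ray ever enters `B`
(`(h' h^{-ρ})' ≤ 0` forces `h = 0` within parameter `h₀/((1-ρ)|h₀'|)`). -/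
theorem exit_of_weightedConcave (𝒟 : VacuumCauchyDevelopment D) [𝒟.metric.HasLeviCivita]
    (B : Set 𝒟.carrier) (f : 𝒟.carrier → ℝ) (ρ : ℝ) (hρ : ρ < 1) (hpos : ∀ x ∈ B, 0 < f x)
    (habs : ∀ (p : X) (γ : ℝ → 𝒟.carrier) (dom : Set ℝ),
      𝒟.metric.IsNormalisedNullRayFrom 𝒟.timeOrientation 𝒟.embed 𝒟.normal p γ dom →
      ∀ t₁ ∈ dom, ∀ t₂ ∈ dom, t₁ ≤ t₂ → γ t₁ ∈ B → γ t₂ ∈ B)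
    (hcrush : ∀ (p : X) (γ : ℝ → 𝒟.carrier) (dom : Set ℝ),
      𝒟.metric.IsNormalisedNullRayFrom 𝒟.timeOrientation 𝒟.embed 𝒟.normal p γ dom →
      ∀ t₁ t₂ : ℝ, t₁ < t₂ → Icc t₁ t₂ ⊆ dom → (∀ t ∈ Icc t₁ t₂, γ t ∈ B) →
        ContDiffOn ℝ 2 (f ∘ γ) (Icc t₁ t₂) ∧
        ∀ t ∈ Ioo t₁ t₂, deriv (f ∘ γ) t < 0 ∧
          (f ∘ γ) t * deriv (deriv (f ∘ γ)) t ≤ ρ * deriv (f ∘ γ) t ^ 2) :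
    ∀ (p : X) (γ : ℝ → 𝒟.carrier) (dom : Set ℝ),
      𝒟.metric.IsNormalisedNullRayFrom 𝒟.timeOrientation 𝒟.embed 𝒟.normal p γ dom →
      dom.OrdConnected → ¬ BddAbove dom → ∀ t ∈ dom, γ t ∉ B := by
  sorry

/-- **Certificate stub of card 3 (KERR CRUSH CERTIFICATE, to be fed by exterior capture).** In an MGHD
with a settled exterior `(O, d)`, the black-hole region `B := J⁺(ιΣ) ∖ closure O` beyond some late
slab is future-absorbing and carries a weighted null-concave crush function (`ρ < 1`): on exact
sub-extremal Kerr region II the Boyer–Lindquist `h = r − r₋` has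
`h r̈/ṙ² = h[R′/2R − 2r/Σ ∓ a² sin2θ √Θ/(Σ√R)]` with `R > 0` on `(r₋, r₊)` (Carter `𝒦 ≥ 0`), `→ 1/2`
at tuned arrivals; its sup `ρ*(a/M)` is the kit job of the card; the dynamical late interior is
`C²`-close to Kerr off a collar of `CH⁺` (Dafermos–Luk arXiv:1710.01722), where blue-shift takes over.
Stated as the existence of SOME crush pair `(B, f, ρ)` making `exit_of_weightedConcave` applicable and
with `B ⊇` the complement of `closure O` in `J⁺(ιΣ)`. -/
def KerrCrushCertificate : Prop :=
  ∀ (X : Type) [TopologicalSpace X] [ChartedSpace E3 X] [IsManifold (𝓡 3) ∞ X] [T2Space X]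
    [SecondCountableTopology X] [ConnectedSpace X], ∀ D ∈ admissibleVacuumData X,
    ∀ 𝒟 : VacuumCauchyDevelopment D, 𝒟.IsMaximal →
    Summit.FinalStateConjecture.HasCompleteNullInfinity 𝒟.toCauchyDevelopment →
    ∀ (O : Set 𝒟.carrier) (d : FinalStateDecomposition 𝒟.toSpacetime O 2),
    (∀ i, Kerr.IsSubextremal (d.mass i) (d.spin i)) →
    O = Summit.FinalStateConjecture.exteriorOf 𝒟.toCauchyDevelopment d.charted →
    Summit.FinalStateConjecture.HasExhaustiveCharts d → Summit.FinalStateConjecture.IsFutureOriented d →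
    ∀ [𝒟.metric.HasLeviCivita], ∃ (B : Set 𝒟.carrier) (f : 𝒟.carrier → ℝ) (ρ : ℝ), ρ < 1 ∧
      𝒟.metric.causalFuture 𝒟.timeOrientation (range 𝒟.embed) \ closure O ⊆ B ∧
      (∀ x ∈ B, 0 < f x) ∧
      (∀ (p : X) (γ : ℝ → 𝒟.carrier) (dom : Set ℝ),
        𝒟.metric.IsNormalisedNullRayFrom 𝒟.timeOrientation 𝒟.embed 𝒟.normal p γ dom →
        ∀ t₁ ∈ dom, ∀ t₂ ∈ dom, t₁ ≤ t₂ → γ t₁ ∈ B → γ t₂ ∈ B) ∧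
      (∀ (p : X) (γ : ℝ → 𝒟.carrier) (dom : Set ℝ),
        𝒟.metric.IsNormalisedNullRayFrom 𝒟.timeOrientation 𝒟.embed 𝒟.normal p γ dom →
        ∀ t₁ t₂ : ℝ, t₁ < t₂ → Icc t₁ t₂ ⊆ dom → (∀ t ∈ Icc t₁ t₂, γ t ∈ B) →
          ContDiffOn ℝ 2 (f ∘ γ) (Icc t₁ t₂) ∧
          ∀ t ∈ Ioo t₁ t₂, deriv (f ∘ γ) t < 0 ∧
            (f ∘ γ) t * deriv (deriv (f ∘ γ)) t ≤ ρ * deriv (f ∘ γ) t ^ 2)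

end Summit.FinalStateConjecture.FinalStateConjecture.Cruxes.SettledCapture.Ideator2

end
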